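import Summits.AtomisticToContinuum.FouriersLaw.Theorems.BondHeatUncertaintyExtensiveSnapshotIrreversibilityEnergyWindowAtomsExpMoment
import Summits.AtomisticToContinuum.FouriersLaw.Theorems.BondHeatUncertaintyExtensiveSnapshotIrreversibilityEnergyWindowAtomsOfRegularity
import Summits.AtomisticToContinuum.FouriersLaw.Theorems.BondHeatUncertaintyExtensiveSnapshotIrreversibilityEnergyWindowRungs

/-!
(SPLIT FOR THE 400-LINE CAP by the landing lane, hand-2 g30: this file = part 1 of 3; sequels `…BondHeatUncertaintyExtensiveSnapshotIrreversibilityEnergyWindowDensityFloorB`, `…BondHeatUncertaintyExtensiveSnapshotIrreversibilityEnergyWindowDensityFloor` import it in a chain; same namespace, all FQNs unchanged.)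
# Crux `ExtensiveSnapshotIrreversibility` (stmt-AtomisticToContinuum-9121): atom A3 `NessDensityFloor` SPLIT

Cell decomp-a2c, lens «grading / quantitative ladder», generation 73 (critic row 1002 (v): "g73 rung
= A3 `NessDensityFloor` first lemma (one-sided `O(δ)` floor from F's defect identity
`integral_generator_add_defect_eq_zero` + weighted resolvent)").

Atom A3 of the energy-window control `(W)` (`…EnergyWindowAtoms.lean`) asks, along every weak
steady-state family `μ_{N,T_L,T_R}` of the pinned anharmonic chain (under weak-NESS uniqueness), for
EVERY slack rate `a > 0`, a one-sided `O(δ)` floor of every measurable reweighting exponent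
`μ_{N,T+δ/2,T−δ/2} = μ_T · e^{φ}`:  `e^{φ} ≥ 1 − C₃|δ|(1+H)^m e^{aH}`  `μ_T`-a.e.

ANALYSIS.  A pointwise floor has two independent ingredients: (i) a GLOBAL `O(δ)` bound on the
density defect `e^{φ} − 1` in an integrated, energy-weighted norm — this is where the defect identity
(`L_{T,T}^† (e^{φ} − 1) μ_T = −(γδ/2) D^† μ_δ`, F §1) and the weighted resolvent / linear-response
theory of the hypoelliptic NESS dynamics act; (ii) a LOCAL conversion of the integrated bound into a
pointwise one-sided bound with constants polynomial in the base-point energy — an interior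
(hypoelliptic, kinetic De Giorgi–Moser type) mean-value inequality for the stationary equation, the
Gibbs weight `e^{H(x)/T}` of the unit ball around `x` being paid for by the weight `e^{θH}` of the
norm in (i) (`θ ↑ 1/T` as the slack `a ↓ 0`).  Generator-level or fixed-time positivity certificates
(sub-solutions `1 − C|δ|W`) do NOT work: `e^{θH}` is not a generator-level Lyapunov function and the
twisted kernels heat at low energy (memo `A3i-ATTACK-g73.md`).  This file therefore files the GRADED
SPLIT `A3 ⟸ A3i ∧ A3p` with the seam PROVED and places every new piece on the ladder:

* `NessWeightedL1Response` (A3i) — for every `0 < θ < 1/T`: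
  `∫ e^{θH} |e^{φ} − 1| dμ_T ≤ C|δ|` for `0 < |δ| < δ₀` and every measurable reweighting exponent
  `φ` (weighted-`L¹` = weighted total-variation LINEAR RESPONSE of the NESS at equilibrium,
  Hairer–Majda 2010 framework + Rey-Bellet–Thomas 2002 / Carmona 2007 weighted spectral gap; the
  `Integrable` clause = the `e^{θH}`-moment of `μ_δ`, i.e. A1⁺ below) — OPEN · INSTRUMENTABLE;
* `NessFloorMeanValue` (A3p) — for every `a > 0`, `0 < θ < 1/T`: `μ_T`-a.e.
  `1 − e^{φ(x)} ≤ C (1+H(x))^m e^{(1/T − θ + a)H(x)} (∫ e^{θH}|e^{φ} − 1| dμ_T + |δ|)`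
  (local one-sided mean-value inequality for `w = e^{φ} − 1`, which solves
  `L_{T+δ/2,T−δ/2}^† (w μ_T)… = O(δ)`-sourced stationary kinetic equation; the `+|δ|` is the source
  term) — OPEN · ATTACKABLE (Golse–Imbert–Mouhot–Vasseur 2019 / Anceschi–Rebucci local boundedness
  for kinetic Fokker–Planck equations with rough coefficients, iterated along the chain's Hörmander
  brackets; constants polynomial in `1 + H(x)` is the new part);
* `NessExpMomentBoundFull` (A1⁺) — A1 for EVERY `0 < θ < 1/T` (not one `θ`): PROVED here from the
  uniform CEHR drift theorem of `…EnergyWindowExpMoment.lean` (ceiling `Tmax = (T + 1/θ)/2`).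

Proved here (no `sorry`, standard axioms):

* ★ `nessDensityFloor_of_weightedL1Response_of_floorMeanValue` — **the seam `A3i → A3p → A3`**:
  given `a`, take `s = min (a/2) (1/(2T))`, `θ = 1/T − s`, slack `a/2` in A3p; then
  `1/T − θ + a/2 ≤ a` and `C₃ = C_p (max C_i 0 + 1)`;
* `nessExpMomentBoundFull_holds` — **A1⁺ PROVED**; `nessExpMomentBound_of_full` — A1⁺ ⟹ A1;
* `nessDensityFloor_implies_floorMeanValue` — **A3 ⟹ A3p** (A3p is a CONSEQUENCE of A3: strictly on
  the way, the `+|δ|` source term makes it so), hence `A3 ⟺ A3 ∧ A3p` and the split loses nothing on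
  the A3p side;
* `nessFloorMeanValue_of_logDensityRegularity` — `(R) ⟹ A3p`;
  `nessWeightedL1Response_of_logDensityRegularity` — `(R) ⟹ A3i` (uses A1⁺: the polynomial
  `(1+H)^k` of (R3) is absorbed into `e^{(θ'−θ)H}`, `θ < θ' < 1/T`, and `∫ e^{θ'H} e^{φ} dμ_T =
  ∫ e^{θ'H} dμ_δ ≤ C₁`): both new atoms sit BELOW the record hypothesis `(R)`;
* `integral_generator_eq_neg_defect` / `response_identity_range` / `abs_response_range_le` — **the
  first rung of A3i from F's defect identity**: for `u ∈ C_c^∞` and every weak steady state `ν` at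
  `(T+δ/2, T−δ/2)`, `∫ L_{T,T}u dν − ∫ L_{T,T}u dμ_T = −(γδ/2) ∫ D u dν`, `D = ∂²_{p_0} − ∂²_{p_{N−1}}`
  — i.e. A3i holds EXACTLY (with constant `γ/2 · sup|Du|`) on the range of `L_{T,T}` over `C_c^∞`;
  A3i is the statement that this extends from `Range(L_{T,T})` to all `|g| ≤ e^{θH}` (invert
  `L_{T,T}` in the weighted space: the resolvent step);
* `energyWindowControl_of_atoms₅` / `snapshotKLUpperExpansion_of_atoms₅` — **the junction**
  `A0 → A2 → A3i → A3p → A4 → (W) → K_fix`;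
* `NessWeightedTVResponse` + `nessWeightedTVResponse_of_weightedL1Response` /
  `nessWeightedL1Response_of_weightedTVResponse` (§7) — **A3i ⟺ (given A0) its representative-free
  form**: `e^{θH} ∈ L¹(μ_δ)` and `|∫ g dμ_δ − ∫ g dμ_T| ≤ C|δ|` for every measurable `|g| ≤ e^{θH}`,
  i.e. Lipschitz continuity of `δ ↦ μ_{N,T+δ/2,T−δ/2}` at `0` in the `e^{θH}`-weighted total-variation
  norm (the norm of Rey-Bellet's lectures, Thm 8.7, and of the Hairer–Majda response theorem).

Ladder bookkeeping (9121, fixed-`N` half `K_fix`): `K_fix ⟸ (W) ⟸ A0 ∧ A2 ∧ A3i ∧ A3p ∧ A4`, A0 a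
tree theorem, A1/A1⁺ PROVED; open leaves A2 (IDEA-NEEDED), A3i (INSTRUMENTABLE: `∫ e^{θH}|f_δ − 1| dμ_T
∝ δ` is measurable on small anharmonic chains), A3p (ATTACKABLE-L), A4 (OPEN); every open leaf is
implied by `(R)` (this file + `…AtomsOfRegularity.lean`).

References: M. Hairer, A. J. Majda, Nonlinearity 23 (2010) 909–922 (arXiv:0909.4313), Thm 2.1–2.3;
L. Rey-Bellet, L. E. Thomas, CMP 225 (2002) 305–329, Thm 1.2/4.1; P. Carmona, Stoch. Proc. Appl. 117
(2007) 1076–1092, Thm 1; J.-P. Eckmann, M. Hairer, CMP 212 (2000) 105–164, §3–4; J.-P. Eckmann,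
C.-A. Pillet, L. Rey-Bellet, CMP 201 (1999) 657–697, Thm 3.8; F. Golse, C. Imbert, C. Mouhot,
A. F. Vasseur, Ann. Sc. Norm. Super. Pisa (5) 19 (2019) 253–295 (arXiv:1607.08068), Thm 4 (Harnack)
and Thm 12 (upper bounds for non-negative `L²` sub-solutions) in the arXiv numbering; J. Guerand,
C. Imbert, weak Harnack inequality for kinetic Fokker–Planck equations (hal-03133950);
L. Rey-Bellet, Open classical systems, in: Open Quantum Systems II, LNM 1881 (2006), Lemma 3.6 and
Thm 3.11 (`e^{θG}` Lyapunov for `θ < β_min`) and Ergodic properties of Markov processes, ibid.,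
Thm 8.7 (weighted total-variation norm); N. Cuneo, J.-P. Eckmann, M. Hairer, L. Rey-Bellet,
EJP 23 (2018) no. 55, Thm 2.13, Rem 5.2.
-/

noncomputable section

namespace Summit.AtomisticToContinuum.FouriersLaw.Theorems.ExtensiveSnapshotIrreversibility.EnergyWindow

open MeasureTheory Filter Topology Real
open scoped ENNReal NNReal
open Literature.MathematicalPhysics.KineticTheory.HeatConduction
-- landing revision (as in the landed `…EnergyWindowTree` / `…EnergyWindow`): the seat namespace `Tree` of re-proved tree lemmas is gone;
-- the originals are opened instead.
open Summit.AtomisticToContinuum.FouriersLaw.Theorems.ExtensiveSnapshotIrreversibility.Negative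
open Summit.AtomisticToContinuum.FouriersLaw.Theorems.ExtensiveSnapshotIrreversibility.ClausiusBudget.OddLogDensity

variable {N : ℕ}

/-! ## 0. (The one real inequality `|e^x − 1| ≤ |x|(e^x + 1)` of the seat file's §0 is used only in §4; on landing it
moved into part 2 as a private helper — its public twin is `Literature.Probability.MarkovChains.HMC.abs_exp_sub_one_le`, dedup gate p850232.) -/

/-! ## 1. The two halves of A3 and the full-range exponential moment -/

/-- **A1⁺ `NessExpMomentBoundFull` (A1 for EVERY rate `θ < 1/T`)**: along every steady-state family
of the pinned chain (under weak-NESS uniqueness), for `T > 0`, `N ≥ 2` and every `0 < θ < 1/T` there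
are `δ₀ > 0` and `C₁` with `e^{θH} ∈ L¹(μ_{N,T+δ/2,T−δ/2})` and `∫ e^{θH} dμ_{N,T+δ/2,T−δ/2} ≤ C₁`
for `0 < |δ| < δ₀`.  PROVED below (`nessExpMomentBoundFull_holds`) — a THEOREM of this file for the pinned chain (after
Cuneo–Eckmann–Hairer–Rey-Bellet 2018, Thm 2.13 (2) and Rem 5.2; the def only NAMES the proved statement, it is not a literature
fact to be taken as a hypothesis). [route statement · this cell · proved] -/
def NessExpMomentBoundFull : Prop :=
  ∀ ω₂ lam β γ : ℝ, 0 < ω₂ → 0 < lam → 0 < β → 0 < γ →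
    (∀ (N : ℕ) (T_L T_R : ℝ), 0 < T_L → 0 < T_R → ∀ μ ν : Measure (PhaseSpace N),
      (pinnedChain ω₂ lam β γ).IsSteadyState N T_L T_R μ →
      (pinnedChain ω₂ lam β γ).IsSteadyState N T_L T_R ν → μ = ν) →
    ∀ μ : (N : ℕ) → ℝ → ℝ → Measure (PhaseSpace N),
      (∀ (N : ℕ) (T_L T_R : ℝ), 0 < T_L → 0 < T_R →
        (pinnedChain ω₂ lam β γ).IsSteadyState N T_L T_R (μ N T_L T_R)) →
      ∀ T : ℝ, 0 < T → ∀ N : ℕ, 2 ≤ N → ∀ θ : ℝ, 0 < θ → θ < 1 / T →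
        ∃ δ₀ C₁ : ℝ, 0 < δ₀ ∧
          ∀ δ : ℝ, δ ≠ 0 → |δ| < δ₀ →
            Integrable (fun x => Real.exp (θ * (pinnedChain ω₂ lam β γ).hamiltonian N x))
                (μ N (T + δ / 2) (T - δ / 2)) ∧
              ∫ x, Real.exp (θ * (pinnedChain ω₂ lam β γ).hamiltonian N x)
                ∂(μ N (T + δ / 2) (T - δ / 2)) ≤ C₁

/-- **A3i `NessWeightedL1Response` (the GLOBAL half of A3: weighted-`L¹` linear response of the
NESS at equilibrium)**: along every steady-state family of the pinned chain (under weak-NESS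
uniqueness), for `T > 0`, `N ≥ 2` and every `0 < θ < 1/T` there are `δ₀ > 0`, `C` such that for
`0 < |δ| < δ₀` and EVERY measurable `φ` with `μ_{N,T+δ/2,T−δ/2} = μ_T · e^{φ}`:
`e^{θH}(e^{φ} − 1) ∈ L¹(μ_T)` and `∫ e^{θH} |e^{φ} − 1| dμ_T ≤ C |δ|`
(equivalently `|μ_δ(g) − μ_T(g)| ≤ C|δ|` for all measurable `|g| ≤ e^{θH}`).
Why it might fail: the `O(δ)` needs a `δ`-UNIFORM spectral gap of the NESS dynamics in the
`e^{θH}`-weighted norm for `θ` up to `1/T` (Rey-Bellet–Thomas / Carmona give `θ < 1/T_max` with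
constants degenerating as `θT_max → 1`) plus one momentum derivative on the semigroup against the
bath Fisher information; if the gap constant blows up as `θ ↑ 1/T`, only `θ ≤ θ₀` survives and the
seam yields A3 only for slack `a > 1/T − θ₀`. [route statement · this cell; NOT a literature fact] -/
def NessWeightedL1Response : Prop :=
  ∀ ω₂ lam β γ : ℝ, 0 < ω₂ → 0 < lam → 0 < β → 0 < γ →
    (∀ (N : ℕ) (T_L T_R : ℝ), 0 < T_L → 0 < T_R → ∀ μ ν : Measure (PhaseSpace N),
      (pinnedChain ω₂ lam β γ).IsSteadyState N T_L T_R μ →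
      (pinnedChain ω₂ lam β γ).IsSteadyState N T_L T_R ν → μ = ν) →
    ∀ μ : (N : ℕ) → ℝ → ℝ → Measure (PhaseSpace N),
      (∀ (N : ℕ) (T_L T_R : ℝ), 0 < T_L → 0 < T_R →
        (pinnedChain ω₂ lam β γ).IsSteadyState N T_L T_R (μ N T_L T_R)) →
      ∀ T : ℝ, 0 < T → ∀ N : ℕ, 2 ≤ N → ∀ θ : ℝ, 0 < θ → θ < 1 / T →
        ∃ δ₀ C : ℝ, 0 < δ₀ ∧
          ∀ δ : ℝ, δ ≠ 0 → |δ| < δ₀ →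
            ∀ φ : PhaseSpace N → ℝ, Measurable φ →
              μ N (T + δ / 2) (T - δ / 2) =
                ((pinnedChain ω₂ lam β γ).gibbsMeasure N T).withDensity
                  (fun x => ENNReal.ofReal (Real.exp (φ x))) →
              Integrable (fun x => Real.exp (θ * (pinnedChain ω₂ lam β γ).hamiltonian N x) *
                  (Real.exp (φ x) - 1)) ((pinnedChain ω₂ lam β γ).gibbsMeasure N T) ∧
                ∫ x, Real.exp (θ * (pinnedChain ω₂ lam β γ).hamiltonian N x) *
                    |Real.exp (φ x) - 1| ∂((pinnedChain ω₂ lam β γ).gibbsMeasure N T) ≤ C * |δ|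

/-- **A3p `NessFloorMeanValue` (the LOCAL half of A3: a Gibbs-weighted one-sided mean-value
inequality for the density defect)**: along every steady-state family of the pinned chain (under
weak-NESS uniqueness), for `T > 0`, `N ≥ 2`, every slack `a > 0` and every `0 < θ < 1/T` there are
`δ₀ > 0`, `C ≥ 0`, `m` such that for `0 < |δ| < δ₀` and EVERY measurable `φ` with
`μ_{N,T+δ/2,T−δ/2} = μ_T · e^{φ}` and `e^{θH}(e^{φ} − 1) ∈ L¹(μ_T)`:  `μ_T`-a.e.
`1 − e^{φ(x)} ≤ C (1 + H(x))^m e^{(1/T − θ + a) H(x)} (∫ e^{θH}|e^{φ} − 1| dμ_T + |δ|)`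
(the negative part of `w = e^{φ} − 1` at `x` is controlled by its global `e^{θH}`-weighted `L¹(μ_T)`
norm — the Gibbs weight `e^{H/T}` of the unit ball at `x` against the weight `e^{θH}` of the norm
costs `e^{(1/T−θ)H(x)}`, gradients of `H` across the ball cost `e^{aH}` — plus the size `|δ|` of the
source in the stationary equation `L_{T+δ/2,T−δ/2}^†(w μ_T) = −(γδ/2) D^† μ_T`).  A CONSEQUENCE of A3
(`nessDensityFloor_implies_floorMeanValue`).
Why it might fail: interior `L^∞–L¹` (De Giorgi–Moser / GIMV-type) estimates are in print for
kinetic Fokker–Planck operators with ONE velocity block; here the noise acts on `p_0, p_{N−1}` only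
and reaches the bulk through `N` commutators, and the polynomial dependence `(1+H(x))^m` of the
local constant on the base point is not in print. [route statement · this cell; NOT a literature fact] -/
def NessFloorMeanValue : Prop :=
  ∀ ω₂ lam β γ : ℝ, 0 < ω₂ → 0 < lam → 0 < β → 0 < γ →
    (∀ (N : ℕ) (T_L T_R : ℝ), 0 < T_L → 0 < T_R → ∀ μ ν : Measure (PhaseSpace N),
      (pinnedChain ω₂ lam β γ).IsSteadyState N T_L T_R μ →
      (pinnedChain ω₂ lam β γ).IsSteadyState N T_L T_R ν → μ = ν) →
    ∀ μ : (N : ℕ) → ℝ → ℝ → Measure (PhaseSpace N),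
      (∀ (N : ℕ) (T_L T_R : ℝ), 0 < T_L → 0 < T_R →
        (pinnedChain ω₂ lam β γ).IsSteadyState N T_L T_R (μ N T_L T_R)) →
      ∀ T : ℝ, 0 < T → ∀ N : ℕ, 2 ≤ N → ∀ a : ℝ, 0 < a → ∀ θ : ℝ, 0 < θ → θ < 1 / T →
        ∃ δ₀ C : ℝ, ∃ m : ℕ, 0 < δ₀ ∧ 0 ≤ C ∧
          ∀ δ : ℝ, δ ≠ 0 → |δ| < δ₀ →
            ∀ φ : PhaseSpace N → ℝ, Measurable φ →
              μ N (T + δ / 2) (T - δ / 2) =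
                ((pinnedChain ω₂ lam β γ).gibbsMeasure N T).withDensity
                  (fun x => ENNReal.ofReal (Real.exp (φ x))) →
              Integrable (fun x => Real.exp (θ * (pinnedChain ω₂ lam β γ).hamiltonian N x) *
                  (Real.exp (φ x) - 1)) ((pinnedChain ω₂ lam β γ).gibbsMeasure N T) →
              ∀ᵐ x ∂((pinnedChain ω₂ lam β γ).gibbsMeasure N T),
                1 - Real.exp (φ x) ≤
                  C * (1 + (pinnedChain ω₂ lam β γ).hamiltonian N x) ^ m *
                    Real.exp ((1 / T - θ + a) * (pinnedChain ω₂ lam β γ).hamiltonian N x) *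
                    ((∫ y, Real.exp (θ * (pinnedChain ω₂ lam β γ).hamiltonian N y) *
                        |Real.exp (φ y) - 1| ∂((pinnedChain ω₂ lam β γ).gibbsMeasure N T)) + |δ|)

/-! ## 2. The seam `A3i → A3p → A3` -/

/-- ★ **THE SEAM `A3 ⟸ A3i ∧ A3p`.**  Given the slack `a > 0` of A3, put `s := min (a/2) (1/(2T))`,
`θ := 1/T − s ∈ [1/(2T), 1/T)` and use A3p with slack `a/2`: its exponent is
`1/T − θ + a/2 = s + a/2 ≤ a`, and A3i at the same `θ` bounds the weighted norm by `C_i|δ|`, whence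
`1 − e^{φ} ≤ C_p (max C_i 0 + 1) |δ| (1+H)^m e^{aH}` a.e. [folklore] -/
theorem nessDensityFloor_of_weightedL1Response_of_floorMeanValue (hi : NessWeightedL1Response)
    (hp : NessFloorMeanValue) : NessDensityFloor := by
  intro ω₂ lam β γ hω hl hβ hγ hU μ hμ T hT N hN a ha
  have hH0 : ∀ x, 0 ≤ (pinnedChain ω₂ lam β γ).hamiltonian N x :=
    pinnedChain_hamiltonian_nonneg hω.le hl.le hβ.le γ N
  -- parameters
  have hT2 : 0 < 1 / (2 * T) := by positivity
  have h2T : 1 / (2 * T) < 1 / T := one_div_lt_one_div_of_lt hT (by linarith)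
  obtain ⟨s, hs0, hsa, hsT⟩ : ∃ s : ℝ, 0 < s ∧ s ≤ a / 2 ∧ s ≤ 1 / (2 * T) :=
    ⟨min (a / 2) (1 / (2 * T)), lt_min (by positivity) hT2, min_le_left _ _, min_le_right _ _⟩
  have hθ0 : 0 < 1 / T - s := by linarith
  have hθ1 : 1 / T - s < 1 / T := by linarith
  obtain ⟨δ₁, Ci, hδ₁, h1⟩ := hi ω₂ lam β γ hω hl hβ hγ hU μ hμ T hT N hN (1 / T - s) hθ0 hθ1
  obtain ⟨δ₂, Cp, m, hδ₂, hCp, h2⟩ :=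
    hp ω₂ lam β γ hω hl hβ hγ hU μ hμ T hT N hN (a / 2) (by positivity) (1 / T - s) hθ0 hθ1
  refine ⟨min δ₁ δ₂, Cp * (max Ci 0 + 1), m, lt_min hδ₁ hδ₂, fun δ hδ hδ' φ hφm hrep => ?_⟩
  obtain ⟨hint, hI⟩ := h1 δ hδ (hδ'.trans_le (min_le_left _ _)) φ hφm hrep
  have hae := h2 δ hδ (hδ'.trans_le (min_le_right _ _)) φ hφm hrep hint
  have hI0 : 0 ≤ ∫ y, exp ((1 / T - s) * (pinnedChain ω₂ lam β γ).hamiltonian N y) *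
      |exp (φ y) - 1| ∂((pinnedChain ω₂ lam β γ).gibbsMeasure N T) :=
    integral_nonneg fun y => mul_nonneg (exp_pos _).le (abs_nonneg _)
  have hIle : (∫ y, exp ((1 / T - s) * (pinnedChain ω₂ lam β γ).hamiltonian N y) *
      |exp (φ y) - 1| ∂((pinnedChain ω₂ lam β γ).gibbsMeasure N T)) + |δ| ≤ (max Ci 0 + 1) * |δ| := by
    have : Ci * |δ| ≤ max Ci 0 * |δ| := mul_le_mul_of_nonneg_right (le_max_left _ _) (abs_nonneg _)
    linarith
  filter_upwards [hae] with x hx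
  have hexp : exp ((1 / T - (1 / T - s) + a / 2) * (pinnedChain ω₂ lam β γ).hamiltonian N x) ≤
      exp (a * (pinnedChain ω₂ lam β γ).hamiltonian N x) :=
    exp_le_exp.2 (mul_le_mul_of_nonneg_right (by linarith) (hH0 x))
  have hpm : 0 ≤ (1 + (pinnedChain ω₂ lam β γ).hamiltonian N x) ^ m :=
    pow_nonneg (by linarith [hH0 x]) _
  have key : Cp * (1 + (pinnedChain ω₂ lam β γ).hamiltonian N x) ^ m *
        exp ((1 / T - (1 / T - s) + a / 2) * (pinnedChain ω₂ lam β γ).hamiltonian N x) *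
        ((∫ y, exp ((1 / T - s) * (pinnedChain ω₂ lam β γ).hamiltonian N y) *
          |exp (φ y) - 1| ∂((pinnedChain ω₂ lam β γ).gibbsMeasure N T)) + |δ|) ≤
      Cp * (max Ci 0 + 1) * |δ| * (1 + (pinnedChain ω₂ lam β γ).hamiltonian N x) ^ m *
        exp (a * (pinnedChain ω₂ lam β γ).hamiltonian N x) := by
    calc Cp * (1 + (pinnedChain ω₂ lam β γ).hamiltonian N x) ^ m *
          exp ((1 / T - (1 / T - s) + a / 2) * (pinnedChain ω₂ lam β γ).hamiltonian N x) *
          ((∫ y, exp ((1 / T - s) * (pinnedChain ω₂ lam β γ).hamiltonian N y) *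
            |exp (φ y) - 1| ∂((pinnedChain ω₂ lam β γ).gibbsMeasure N T)) + |δ|)
        ≤ Cp * (1 + (pinnedChain ω₂ lam β γ).hamiltonian N x) ^ m *
            exp (a * (pinnedChain ω₂ lam β γ).hamiltonian N x) * ((max Ci 0 + 1) * |δ|) :=
          mul_le_mul (mul_le_mul_of_nonneg_left hexp (mul_nonneg hCp hpm)) hIle
            (by positivity) (by positivity)
      _ = Cp * (max Ci 0 + 1) * |δ| * (1 + (pinnedChain ω₂ lam β γ).hamiltonian N x) ^ m *
            exp (a * (pinnedChain ω₂ lam β γ).hamiltonian N x) := by ring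
  linarith [hx, key]

/-! ## 3. A1⁺ proved; A1⁺ ⟹ A1 -/

/-- ★ **A1⁺ PROVED**: for `0 < θ < 1/T` take the ceiling `Tmax := (T + 1/θ)/2 ∈ (T, 1/θ)` in the
uniform CEHR moment theorem `isSteadyState_integral_exp_mul_hamiltonian_le_uniform` and
`δ₀ := min T (1/θ − T)`, so that both bath temperatures `T ± δ/2` lie in `(0, Tmax]`.
[cite: CuneoEckmannHairerReyBellet2018, Thm 2.13 (2) and Rem 5.2] -/
theorem nessExpMomentBoundFull_holds : NessExpMomentBoundFull := by
  intro ω₂ lam β γ hω hl hβ hγ hU μ hμ T hT N hN θ hθ hθ1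
  have hN0 : 0 < N := lt_of_lt_of_le (by norm_num) hN
  have hTθ : T < 1 / θ := (lt_one_div hθ hT).1 hθ1
  have hTmax : 0 < (T + 1 / θ) / 2 := by positivity
  have hθ' : θ < 1 / ((T + 1 / θ) / 2) := (lt_one_div hTmax hθ).1 (by linarith)
  obtain ⟨C₁, -, h⟩ :=
    isSteadyState_integral_exp_mul_hamiltonian_le_uniform hω hl hβ hγ hU hN0 hTmax hθ hθ'
  refine ⟨min T (1 / θ - T), C₁, lt_min hT (by linarith), fun δ _ hδ => ?_⟩
  have hδT : |δ| < T := hδ.trans_le (min_le_left _ _)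
  have hδθ : |δ| < 1 / θ - T := hδ.trans_le (min_le_right _ _)
  obtain ⟨hδ1, hδ2⟩ := abs_lt.1 hδT
  obtain ⟨hδ3, hδ4⟩ := abs_lt.1 hδθ
  have hTL : 0 < T + δ / 2 := by linarith
  have hTR : 0 < T - δ / 2 := by linarith
  exact h _ _ hTL hTR (by linarith) (by linarith) _ (hμ N _ _ hTL hTR)

/-- **A1⁺ ⟹ A1** (`θ = 1/(2T)`). [folklore] -/
theorem nessExpMomentBound_of_full (h : NessExpMomentBoundFull) : NessExpMomentBound := by
  intro ω₂ lam β γ hω hl hβ hγ hU μ hμ T hT N hN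
  have hθ : 0 < 1 / (2 * T) := by positivity
  have hθ1 : 1 / (2 * T) < 1 / T := one_div_lt_one_div_of_lt hT (by linarith)
  obtain ⟨δ₀, C₁, hδ₀, h1⟩ := h ω₂ lam β γ hω hl hβ hγ hU μ hμ T hT N hN (1 / (2 * T)) hθ hθ1
  exact ⟨δ₀, 1 / (2 * T), C₁, hδ₀, hθ, h1⟩

end Summit.AtomisticToContinuum.FouriersLaw.Theorems.ExtensiveSnapshotIrreversibility.EnergyWindow

end
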